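import Mathlib

/-!
# C4RankLemma — KERNEL PROOF of the RANK LEMMA `RL(m)` for ALL `m` (strong form: joint range of dimension ≤ m),
of `NoSplitWindow n` for all `n`, and of `NSWReduction n` (hsemireg-c4-1 g24, memo `C4-RLINF-c4-1-g24.md`)

Token: `line stmt-HodgeConjecture-18881 Cruxes/BlochSeedDiscOne/Lines/birth.lean 814a6a70c14e831a stub_rung_pad4_seedAt`.

HONEST SCOPE.  Nothing in this file is proved toward HC ∕ HC_CM ∕ HC_AV ∕ №4 ∕ 26512 ∕ 18881 ∕ H2, and the registered stub
`stub_rung_pad4_seedAt` is not touched.  This file settles, inside the kernel, the linear-algebra statements that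
`Cruxes/BlochSeedDiscOne/C4HNWindow.lean` (c4-1 g23) recorded as NAMED PROPOSITIONS ONLY (`RankLemma m n` — pen-proved there for
m ≤ 5 and conjectured for m ≥ 6 —, `NoSplitWindow n`, `NSWReduction n`).  The definitions `minor2`, `minor4`, `Wedge2SumZero`,
`RankLemma`, `RankLemmaUpToThree`, `RankLemmaUpToFive`, `NoSplitWindow`, `NSWReduction`, `SplitWNSH` below are VERBATIM COPIES of the
g23 ones (this file imports only Mathlib so that it elaborates on a farm snapshot that predates `C4HNWindow`; the bridge file
`C4RankLemmaBridge.lean` transfers the theorems to the `HSemireg.C4HNWindow` names by `defeq`).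

THEOREM RL∞ (memo §1).  Let `E : ι → Herm_n(ℂ)` be a finite Hermitian family with `Σ_j ∧²E_j = 0` (`Wedge2SumZero E`).  Then the
JOINT RANGE `J = Σ_j range(E_j)` has `dim J ≤ dim K` for every subspace `K ≤ ℂ^ι` containing all the row vectors
`(j ↦ (E_j y)_a)`; in particular `dim J ≤ |ι|` (`finrank_J_le_card`), `dim J ≤ dim span{(j ↦ (E_j)_{ac})}` (= dim_ℂ span{E_j},
`finrank_J_le_rowSpace`), and every complex combination `Σ c_j E_j` has rank ≤ |ι| (`rank_sum_smul_le`) — hence `RankLemma m n` for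
all `m n` (`rankLemma_all`).  With four roots summing to zero the row vectors lie in the hyperplane `Σ_j v_j = 0`, so `dim J ≤ 3` and
all 4×4 minors vanish: `noSplitWindow_all`, `nswReduction_all`, `not_splitWNSH` (no numerically split point of the WNSH-LF window,
now UNCONDITIONAL).

PROOF (memo §1, formalised below).  (I′)∕Fact 2 (`fact2`): from `Σ_j ((E_j)_{ac}(E_j)_{bd} − (E_j)_{ad}(E_j)_{bc}) = 0` and
Hermitian symmetry, `y ⊥ span{E_j x}` implies `Σ_j (E_j x)_a · conj((E_j y)_b) = 0` for all `a, b` — the row spaces `U_x, U_y ⊂ ℂ^ι`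
of `A_x = [E_1x|…|E_mx]` and `A_y` are orthogonal.  Greedy induction (`step`, invariant `Inv`): keep `N ≤ ℂⁿ` (vectors normal to
all points chosen so far) and `Z ≤ K` (orthogonal sum of their row spaces) with `n ≤ dim N + dim Z` and `U_y ⊥ Z` for every
`y ∈ N`; while some `y₀ ∈ N` has `A_{y₀} ≠ 0`, replace `N ↦ N ∩ ker A_{y₀}ᴴ`, `Z ↦ Z ⊕ U_{y₀}` (rank–nullity and
`rank A = rank Aᴴ` keep the invariant, `dim Z` grows).  At a terminal state every `y ∈ N` is killed by all `E_j`, so `J ∩ N = 0`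
(`J ⊥ N`) and `dim J ≤ n − dim N ≤ dim Z ≤ dim K` (`terminal`).

No `sorry`, no `axiom`, no `instance`, no `notation`, no `native_decide`, no `set_option`.
-/

namespace HSemireg.C4RankLemma

open Matrix BigOperators
open scoped ComplexOrder

section Compounds

variable {R : Type*} [CommRing R] {n : ℕ} {ι : Type*} [Fintype ι]

/-- the 2×2 minor of `M` on rows `a,b` and columns `c,d` (verbatim copy of `HSemireg.C4HNWindow.minor2`) -/
def minor2 (M : Matrix (Fin n) (Fin n) R) (a b c d : Fin n) : R :=
  M a c * M b d - M a d * M b c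

/-- the 3×3 minor of `M` on rows `r` and columns `s` (verbatim copy) -/
def minor3 (M : Matrix (Fin n) (Fin n) R) (r s : Fin 3 → Fin n) : R :=
  (M.submatrix r s).det

/-- the 4×4 minor of `M` on rows `r` and columns `s` (verbatim copy) -/
def minor4 (M : Matrix (Fin n) (Fin n) R) (r s : Fin 4 → Fin n) : R :=
  (M.submatrix r s).det

/-- `Σ_j ∧²(D j) = 0` entrywise (verbatim copy of `HSemireg.C4HNWindow.Wedge2SumZero`). -/
def Wedge2SumZero (D : ι → Matrix (Fin n) (Fin n) R) : Prop :=
  ∀ a b c d : Fin n, ∑ j, minor2 (D j) a b c d = 0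

/-- `Σ_j ∧³(D j) = 0` entrywise (verbatim copy). -/
def Wedge3SumZero (D : ι → Matrix (Fin n) (Fin n) R) : Prop :=
  ∀ r s : Fin 3 → Fin n, ∑ j, minor3 (D j) r s = 0

/-- the entry `(r,s)` of `Σ_j ∧⁴(D j)` (verbatim copy). -/
def wedge4Sum (D : ι → Matrix (Fin n) (Fin n) R) (r s : Fin 4 → Fin n) : R :=
  ∑ j, minor4 (D j) r s

/-- a numerically split point of the WNSH-LF window (verbatim copy of `HSemireg.C4HNWindow.SplitWNSH`). -/
def SplitWNSH (D : Fin 4 → Matrix (Fin n) (Fin n) R) : Prop :=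
  (∑ j, D j = 0) ∧ Wedge2SumZero D ∧ Wedge3SumZero D ∧ ∃ r s : Fin 4 → Fin n, wedge4Sum D r s ≠ 0

end Compounds

section Statements

/-- RANK LEMMA `RL(m)` in dimension `n` (verbatim copy of `HSemireg.C4HNWindow.RankLemma`; PROVED below for all `m n`). -/
def RankLemma (m n : ℕ) : Prop :=
  ∀ E : Fin m → Matrix (Fin n) (Fin n) ℂ, (∀ i, (E i).IsHermitian) → Wedge2SumZero E →
    ∀ c : Fin m → ℝ, (∑ i, ((c i : ℂ) • E i)).rank ≤ m

/-- verbatim copy of `HSemireg.C4HNWindow.RankLemmaUpToThree` -/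
def RankLemmaUpToThree : Prop := ∀ m n : ℕ, m ≤ 3 → RankLemma m n

/-- verbatim copy of `HSemireg.C4HNWindow.RankLemmaUpToFive` -/
def RankLemmaUpToFive : Prop := ∀ m n : ℕ, m ≤ 5 → RankLemma m n

/-- verbatim copy of `HSemireg.C4HNWindow.NoSplitWindow` (PROVED below for all `n`). -/
def NoSplitWindow (n : ℕ) : Prop :=
  ∀ D : Fin 4 → Matrix (Fin n) (Fin n) ℂ, (∀ j, (D j).IsHermitian) → (∑ j, D j = 0) → Wedge2SumZero D →
    ∀ j (r s : Fin 4 → Fin n), minor4 (D j) r s = 0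

/-- verbatim copy of `HSemireg.C4HNWindow.NSWReduction` -/
def NSWReduction (n : ℕ) : Prop := RankLemma 3 n → NoSplitWindow n

end Statements

section Core

variable {n : ℕ} {ι : Type*} [Fintype ι] (E : ι → Matrix (Fin n) (Fin n) ℂ)

/-- (H2) rearranged: `Σ_j E_{ac}E_{bd} = Σ_j E_{ad}E_{bc}`. -/
theorem wedge_swap (h2 : Wedge2SumZero E) (a b c d : Fin n) :
    ∑ j, E j a c * E j b d = ∑ j, E j a d * E j b c := by
  have h := h2 a b c d
  simp only [minor2, Finset.sum_sub_distrib] at h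
  exact sub_eq_zero.mp h

/-- FACT 2 (memo §1): if `y ⊥ E_j x` for all `j` then `A_x A_yᴴ = 0` entrywise, i.e.
`Σ_j (E_j x)_a · conj((E_j y)_b) = 0`.  Uses (H2) once (indices `(a,d,c,b)`) and Hermitian symmetry once. -/
theorem fact2 (hE : ∀ j, (E j).IsHermitian) (h2 : Wedge2SumZero E) {x y : Fin n → ℂ}
    (hN : ∀ j, star y ⬝ᵥ (E j *ᵥ x) = 0) (a b : Fin n) :
    ∑ j, (E j *ᵥ x) a * star ((E j *ᵥ y) b) = 0 := by
  have hx : ∀ j, (E j *ᵥ x) a = ∑ c, E j a c * x c := fun j => rfl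
  have hy : ∀ j, star ((E j *ᵥ y) b) = ∑ d, E j d b * star (y d) := by
    intro j
    rw [show (E j *ᵥ y) b = ∑ d, E j b d * y d from rfl, star_sum]
    refine Finset.sum_congr rfl fun d _ => ?_
    rw [star_mul', (hE j).apply d b]
  have hdot : ∀ j, star y ⬝ᵥ (E j *ᵥ x) = ∑ d, star (y d) * ∑ c, E j d c * x c := fun j => rfl
  calc ∑ j, (E j *ᵥ x) a * star ((E j *ᵥ y) b)
      = ∑ j, ∑ c, ∑ d, (x c * star (y d)) * (E j a c * E j d b) := by
        refine Finset.sum_congr rfl fun j _ => ?_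
        rw [hx j, hy j, Finset.sum_mul_sum]
        refine Finset.sum_congr rfl fun c _ => Finset.sum_congr rfl fun d _ => ?_
        ring
    _ = ∑ c, ∑ d, (x c * star (y d)) * ∑ j, E j a c * E j d b := by
        rw [Finset.sum_comm]
        refine Finset.sum_congr rfl fun c _ => ?_
        rw [Finset.sum_comm]
        refine Finset.sum_congr rfl fun d _ => ?_
        rw [Finset.mul_sum]
    _ = ∑ c, ∑ d, (x c * star (y d)) * ∑ j, E j a b * E j d c := by
        refine Finset.sum_congr rfl fun c _ => Finset.sum_congr rfl fun d _ => ?_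
        rw [wedge_swap E h2 a d c b]
    _ = ∑ c, ∑ d, ∑ j, (x c * star (y d)) * (E j a b * E j d c) := by
        refine Finset.sum_congr rfl fun c _ => Finset.sum_congr rfl fun d _ => ?_
        rw [Finset.mul_sum]
    _ = ∑ j, ∑ c, ∑ d, (x c * star (y d)) * (E j a b * E j d c) := by
        symm
        rw [Finset.sum_comm]
        refine Finset.sum_congr rfl fun c _ => ?_
        rw [Finset.sum_comm]
    _ = ∑ j, E j a b * (star y ⬝ᵥ (E j *ᵥ x)) := by
        refine Finset.sum_congr rfl fun j _ => ?_
        rw [hdot j, Finset.sum_comm, Finset.mul_sum]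
        refine Finset.sum_congr rfl fun d _ => ?_
        rw [Finset.mul_sum, Finset.mul_sum]
        refine Finset.sum_congr rfl fun c _ => ?_
        ring
    _ = 0 := by simp [hN]

omit [Fintype ι] in
/-- Hermitian symmetry: `star (E_j v) = star v ᵥ* E_j`. -/
theorem star_mulVec_herm (hE : ∀ j, (E j).IsHermitian) (j : ι) (v : Fin n → ℂ) :
    star (E j *ᵥ v) = star v ᵥ* E j := by
  rw [star_mulVec, (hE j).eq]

omit [Fintype ι] in
/-- FACT 1 (memo §1): `⟨v, E_j u⟩ = ⟨E_j v, u⟩`. -/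
theorem dot_herm (hE : ∀ j, (E j).IsHermitian) (j : ι) (u v : Fin n → ℂ) :
    star v ⬝ᵥ (E j *ᵥ u) = star (E j *ᵥ v) ⬝ᵥ u := by
  rw [star_mulVec_herm E hE j, dotProduct_mulVec]

/-- `A_x = [E_1 x | … | E_m x]`, the `n × ι` matrix whose columns are the `E_j x`. -/
def colMat (x : Fin n → ℂ) : Matrix (Fin n) ι ℂ := Matrix.of fun a j => (E j *ᵥ x) a

/-- row `a` of `A_x`, a vector of `ℂ^ι`. -/
def rowVec (x : Fin n → ℂ) (a : Fin n) : ι → ℂ := fun j => (E j *ᵥ x) a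

/-- the row space `U_x ≤ ℂ^ι` of `A_x`. -/
def U (x : Fin n → ℂ) : Submodule ℂ (ι → ℂ) := Submodule.span ℂ (Set.range (rowVec E x))

/-- `L_x = A_xᴴ` as a linear map `ℂⁿ → ℂ^ι`; its kernel is the set of vectors normal to `x` (orthogonal to every `E_j x`). -/
def L (x : Fin n → ℂ) : (Fin n → ℂ) →ₗ[ℂ] (ι → ℂ) := Matrix.mulVecLin (colMat E x)ᴴ

/-- the JOINT RANGE `J = Σ_j range(E_j) ≤ ℂⁿ`. -/
def J : Submodule ℂ (Fin n → ℂ) := ⨆ j, LinearMap.range (Matrix.mulVecLin (E j))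

theorem finrank_U_eq (x : Fin n → ℂ) : Module.finrank ℂ (U E x) = (colMat E x).rank := by
  rw [Matrix.rank_eq_finrank_span_row]
  rfl

theorem finrank_range_L (x : Fin n → ℂ) :
    Module.finrank ℂ (LinearMap.range (L E x)) = Module.finrank ℂ (U E x) := by
  rw [finrank_U_eq, ← Matrix.rank_conjTranspose (colMat E x)]
  rfl

omit [Fintype ι] in
theorem mem_ker_L {x y : Fin n → ℂ} :
    y ∈ LinearMap.ker (L E x) ↔ ∀ j, star (E j *ᵥ x) ⬝ᵥ y = 0 := by
  rw [LinearMap.mem_ker, funext_iff]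
  rfl

omit [Fintype ι] in
theorem U_le {K : Submodule ℂ (ι → ℂ)} (hK : ∀ y a, rowVec E y a ∈ K) (y : Fin n → ℂ) : U E y ≤ K :=
  Submodule.span_le.mpr (by rintro _ ⟨a, rfl⟩; exact hK y a)

/-- (sesquilinear) orthogonality of two subspaces of `ℂ^ι` for the standard Hermitian form. -/
def SOrth (P Q : Submodule ℂ (ι → ℂ)) : Prop := ∀ p ∈ P, ∀ q ∈ Q, p ⬝ᵥ star q = 0

theorem SOrth.symm {P Q : Submodule ℂ (ι → ℂ)} (h : SOrth P Q) : SOrth Q P := by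
  intro q hq p hp
  rw [dotProduct_comm, star_dotProduct, dotProduct_comm, h p hp q hq, star_zero]

theorem sOrth_span {α β : Type*} {f : α → ι → ℂ} {g : β → ι → ℂ} (h : ∀ a b, f a ⬝ᵥ star (g b) = 0) :
    SOrth (Submodule.span ℂ (Set.range f)) (Submodule.span ℂ (Set.range g)) := by
  intro p hp q hq
  have step1 : ∀ b, p ⬝ᵥ star (g b) = 0 := by
    intro b
    induction hp using Submodule.span_induction with
    | mem p hp =>
        obtain ⟨a, rfl⟩ := hp
        exact h a b
    | zero => exact zero_dotProduct _
    | add p₁ p₂ _ _ h₁ h₂ => rw [add_dotProduct, h₁, h₂, add_zero]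
    | smul c p _ hp => rw [smul_dotProduct, hp, smul_zero]
  induction hq using Submodule.span_induction with
  | mem q hq =>
      obtain ⟨b, rfl⟩ := hq
      exact step1 b
  | zero => rw [star_zero, dotProduct_zero]
  | add q₁ q₂ _ _ h₁ h₂ => rw [star_add, dotProduct_add, h₁, h₂, add_zero]
  | smul c q _ hq' => rw [star_smul, dotProduct_smul, hq', smul_zero]

theorem sOrth_sup {P Z Q : Submodule ℂ (ι → ℂ)} (h₁ : SOrth P Z) (h₂ : SOrth P Q) : SOrth P (Z ⊔ Q) := by
  intro p hp r hr
  obtain ⟨z, hz, q, hq, rfl⟩ := Submodule.mem_sup.mp hr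
  rw [star_add, dotProduct_add, h₁ p hp z hz, h₂ p hp q hq, add_zero]

theorem finrank_sup_of_sOrth {P Q : Submodule ℂ (ι → ℂ)} (h : SOrth P Q) :
    Module.finrank ℂ ↥(P ⊔ Q) = Module.finrank ℂ P + Module.finrank ℂ Q := by
  have hinf : P ⊓ Q = ⊥ := by
    rw [Submodule.eq_bot_iff]
    intro v hv
    obtain ⟨hvP, hvQ⟩ := Submodule.mem_inf.mp hv
    exact dotProduct_self_star_eq_zero.mp (h v hvP v hvQ)
  have key := Submodule.finrank_sup_add_finrank_inf_eq P Q
  rw [hinf, finrank_bot, add_zero] at key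
  exact key

/-- INVARIANT of the greedy induction (memo §1): `N` = vectors normal to every point chosen so far, `Z` = orthogonal sum of
their row spaces, `K` = the ambient bound. -/
structure Inv (K : Submodule ℂ (ι → ℂ)) (N : Submodule ℂ (Fin n → ℂ)) (Z : Submodule ℂ (ι → ℂ)) : Prop where
  dim : n ≤ Module.finrank ℂ N + Module.finrank ℂ Z
  orth : ∀ y ∈ N, SOrth (U E y) Z
  le : Z ≤ K

theorem inv_init (K : Submodule ℂ (ι → ℂ)) : Inv E K ⊤ ⊥ where
  dim := by simp
  orth := by
    intro y _ p _ q hq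
    rw [(Submodule.mem_bot ℂ).mp hq, star_zero, dotProduct_zero]
  le := bot_le

/-- TERMINAL STATE: if every `y ∈ N` is killed by all `E_j`, then `J ∩ N = 0` and `dim J ≤ dim Z`. -/
theorem terminal (hE : ∀ j, (E j).IsHermitian) {K : Submodule ℂ (ι → ℂ)} {N : Submodule ℂ (Fin n → ℂ)}
    {Z : Submodule ℂ (ι → ℂ)} (hI : Inv E K N Z) (hterm : ∀ y ∈ N, ∀ j, E j *ᵥ y = 0) :
    Module.finrank ℂ (J E) ≤ Module.finrank ℂ Z := by
  have hinf : J E ⊓ N = ⊥ := by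
    rw [Submodule.eq_bot_iff]
    intro v hv
    obtain ⟨hvJ, hvN⟩ := Submodule.mem_inf.mp hv
    have hv0 : ∀ j, E j *ᵥ v = 0 := hterm v hvN
    have key : ∀ w ∈ J E, star v ⬝ᵥ w = 0 := by
      intro w hw
      refine Submodule.iSup_induction (motive := fun w => star v ⬝ᵥ w = 0) _ hw ?_ ?_ ?_
      · intro j w hw'
        obtain ⟨u, rfl⟩ := LinearMap.mem_range.mp hw'
        rw [Matrix.mulVecLin_apply, dot_herm E hE j u v, hv0 j, star_zero, zero_dotProduct]
      · exact dotProduct_zero _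
      · intro w₁ w₂ h₁ h₂
        rw [dotProduct_add, h₁, h₂, add_zero]
    exact dotProduct_star_self_eq_zero.mp (key v hvJ)
  have h1 := Submodule.finrank_sup_add_finrank_inf_eq (J E) N
  rw [hinf, finrank_bot, add_zero] at h1
  have h2 : Module.finrank ℂ ↥(J E ⊔ N) ≤ n := (Submodule.finrank_le _).trans (Module.finrank_fin_fun ℂ).le
  have h3 := hI.dim
  omega

/-- INDUCTION STEP: a point `y₀ ∈ N` with `A_{y₀} ≠ 0` lets `Z` grow by `U_{y₀}` (dimension ≥ 1) while the invariant persists. -/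
theorem step (hE : ∀ j, (E j).IsHermitian) (h2 : Wedge2SumZero E) {K : Submodule ℂ (ι → ℂ)}
    (hK : ∀ y a, rowVec E y a ∈ K) {N : Submodule ℂ (Fin n → ℂ)} {Z : Submodule ℂ (ι → ℂ)}
    (hI : Inv E K N Z) {y₀ : Fin n → ℂ} (hy₀ : y₀ ∈ N) {j₀ : ι} (hj₀ : E j₀ *ᵥ y₀ ≠ 0) :
    ∃ N' : Submodule ℂ (Fin n → ℂ), ∃ Z' : Submodule ℂ (ι → ℂ),
      Inv E K N' Z' ∧ Module.finrank ℂ Z + 1 ≤ Module.finrank ℂ Z' := by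
  have hZU : SOrth (U E y₀) Z := hI.orth y₀ hy₀
  have hsup : Module.finrank ℂ ↥(Z ⊔ U E y₀) = Module.finrank ℂ Z + Module.finrank ℂ (U E y₀) :=
    finrank_sup_of_sOrth hZU.symm
  have hUpos : 1 ≤ Module.finrank ℂ (U E y₀) := by
    rw [Submodule.one_le_finrank_iff, Submodule.ne_bot_iff]
    have ha : ∃ a, (E j₀ *ᵥ y₀) a ≠ 0 := by
      by_contra h
      push Not at h
      exact hj₀ (funext h)
    obtain ⟨a, ha⟩ := ha
    exact ⟨rowVec E y₀ a, Submodule.subset_span ⟨a, rfl⟩, fun h => ha (congr_fun h j₀)⟩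
  have hrn : Module.finrank ℂ (LinearMap.range (L E y₀)) + Module.finrank ℂ (LinearMap.ker (L E y₀)) = n := by
    have h := LinearMap.finrank_range_add_finrank_ker (L E y₀)
    rwa [Module.finrank_fin_fun] at h
  have hRU : Module.finrank ℂ (LinearMap.range (L E y₀)) = Module.finrank ℂ (U E y₀) := finrank_range_L E y₀
  have hNK := Submodule.finrank_sup_add_finrank_inf_eq N (LinearMap.ker (L E y₀))
  have hNK_le : Module.finrank ℂ ↥(N ⊔ LinearMap.ker (L E y₀)) ≤ n :=
    (Submodule.finrank_le _).trans (Module.finrank_fin_fun ℂ).le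
  have hdim := hI.dim
  refine ⟨N ⊓ LinearMap.ker (L E y₀), Z ⊔ U E y₀, ⟨by omega, ?_, sup_le hI.le (U_le E hK y₀)⟩, by omega⟩
  intro y hy
  obtain ⟨hyN, hyker⟩ := Submodule.mem_inf.mp hy
  have hN' : ∀ j, star y₀ ⬝ᵥ (E j *ᵥ y) = 0 := by
    intro j
    rw [dot_herm E hE j y y₀]
    exact (mem_ker_L E).mp hyker j
  exact sOrth_sup (hI.orth y hyN) (sOrth_span fun a b => fact2 E hE h2 hN' a b)

/-- THEOREM RL∞, strong form (memo §1): `dim J ≤ dim K` for every `K ≤ ℂ^ι` containing all row vectors `(j ↦ (E_j y)_a)`. -/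
theorem finrank_J_le (hE : ∀ j, (E j).IsHermitian) (h2 : Wedge2SumZero E) (K : Submodule ℂ (ι → ℂ))
    (hK : ∀ y a, rowVec E y a ∈ K) : Module.finrank ℂ (J E) ≤ Module.finrank ℂ K := by
  have key : ∀ k : ℕ, (∃ N : Submodule ℂ (Fin n → ℂ), ∃ Z : Submodule ℂ (ι → ℂ),
      Inv E K N Z ∧ k ≤ Module.finrank ℂ Z) ∨ Module.finrank ℂ (J E) ≤ Module.finrank ℂ K := by
    intro k
    induction k with
    | zero => exact Or.inl ⟨⊤, ⊥, inv_init E K, Nat.zero_le _⟩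
    | succ k ih =>
      rcases ih with ⟨N, Z, hI, hk⟩ | h
      · by_cases hterm : ∀ y ∈ N, ∀ j, E j *ᵥ y = 0
        · exact Or.inr ((terminal E hE hI hterm).trans (Submodule.finrank_mono hI.le))
        · push Not at hterm
          obtain ⟨y₀, hy₀, j₀, hj₀⟩ := hterm
          obtain ⟨N', Z', hI', hZ'⟩ := step E hE h2 hK hI hy₀ hj₀
          exact Or.inl ⟨N', Z', hI', by omega⟩
      · exact Or.inr h
  rcases key (Module.finrank ℂ K + 1) with ⟨N, Z, hI, hk⟩ | h
  · have := Submodule.finrank_mono hI.le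
    omega
  · exact h

/-- RL∞: `dim J ≤ |ι|` (the number of matrices). -/
theorem finrank_J_le_card (hE : ∀ j, (E j).IsHermitian) (h2 : Wedge2SumZero E) :
    Module.finrank ℂ (J E) ≤ Fintype.card ι := by
  have h := finrank_J_le E hE h2 ⊤ (fun _ _ => Submodule.mem_top)
  rwa [finrank_top, Module.finrank_fintype_fun_eq_card] at h

/-- RL∞, `m′`-form: `dim J ≤ dim span{(j ↦ (E_j)_{ac}) : a, c}` (the row space of the `n² × ι` matrix `[vec E_j]_j`, whose
dimension is `dim_ℂ span_ℂ {E_j}`). -/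
theorem finrank_J_le_rowSpace (hE : ∀ j, (E j).IsHermitian) (h2 : Wedge2SumZero E) :
    Module.finrank ℂ (J E) ≤
      Module.finrank ℂ (Submodule.span ℂ (Set.range fun ac : Fin n × Fin n => fun j => E j ac.1 ac.2)) := by
  refine finrank_J_le E hE h2 _ fun y a => ?_
  have hrow : rowVec E y a = ∑ c, y c • (fun j => E j a c) := by
    funext j
    simp only [rowVec, Finset.sum_apply, Pi.smul_apply, smul_eq_mul]
    show (E j *ᵥ y) a = _
    rw [show (E j *ᵥ y) a = ∑ c, E j a c * y c from rfl]
    exact Finset.sum_congr rfl fun c _ => mul_comm _ _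
  rw [hrow]
  exact Submodule.sum_mem _ fun c _ => Submodule.smul_mem _ _ (Submodule.subset_span ⟨(a, c), rfl⟩)

omit [Fintype ι] in
theorem range_le_J (j : ι) : LinearMap.range (Matrix.mulVecLin (E j)) ≤ J E :=
  le_iSup (fun j => LinearMap.range (Matrix.mulVecLin (E j))) j

theorem range_sum_smul_le (c : ι → ℂ) : LinearMap.range (Matrix.mulVecLin (∑ i, c i • E i)) ≤ J E := by
  rintro _ ⟨v, rfl⟩
  rw [Matrix.mulVecLin_apply, Matrix.sum_mulVec]
  refine Submodule.sum_mem _ fun i _ => ?_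
  rw [Matrix.smul_mulVec]
  exact Submodule.smul_mem _ _ (Submodule.mem_iSup_of_mem i (LinearMap.mem_range_self _ v))

/-- RL∞ for combinations: every COMPLEX combination `Σ c_j E_j` has rank ≤ |ι|. -/
theorem rank_sum_smul_le (hE : ∀ j, (E j).IsHermitian) (h2 : Wedge2SumZero E) (c : ι → ℂ) :
    (∑ i, c i • E i).rank ≤ Fintype.card ι :=
  (Submodule.finrank_mono (range_sum_smul_le E c)).trans (finrank_J_le_card E hE h2)

omit [Fintype ι] in
/-- every single `E_j` has rank ≤ dim J. -/
theorem rank_le_finrank_J (j : ι) : (E j).rank ≤ Module.finrank ℂ (J E) :=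
  Submodule.finrank_mono (range_le_J E j)

end Core

section Consequences

/-- THE RANK LEMMA HOLDS FOR ALL `m` AND `n` (g23 conjectured `m ≥ 6`; its m ≤ 5 proof used the LLD theorem — not needed). -/
theorem rankLemma_all (m n : ℕ) : RankLemma m n := by
  intro E hE h2 c
  simpa using rank_sum_smul_le E hE h2 (fun i => (c i : ℂ))

theorem rankLemmaUpToFive_holds : RankLemmaUpToFive := fun m n _ => rankLemma_all m n

theorem rankLemmaUpToThree_holds : RankLemmaUpToThree := fun m n _ => rankLemma_all m n

/-- the linear functional `v ↦ Σ_j v_j` on `ℂ^ι`. -/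
def sumFunctional (ι : Type*) [Fintype ι] : (ι → ℂ) →ₗ[ℂ] ℂ where
  toFun v := ∑ j, v j
  map_add' v w := by simp [Finset.sum_add_distrib]
  map_smul' c v := by simp [Finset.mul_sum]

theorem finrank_ker_sumFunctional_lt (ι : Type*) [Fintype ι] [Nonempty ι] :
    Module.finrank ℂ (LinearMap.ker (sumFunctional ι)) < Fintype.card ι := by
  classical
  obtain ⟨i⟩ := ‹Nonempty ι›
  have hne : LinearMap.ker (sumFunctional ι) ≠ ⊤ := by
    intro htop
    have hmem : (Pi.single i (1 : ℂ) : ι → ℂ) ∈ LinearMap.ker (sumFunctional ι) := htop ▸ Submodule.mem_top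
    rw [LinearMap.mem_ker] at hmem
    simp [sumFunctional] at hmem
  have h := Submodule.finrank_lt hne
  rwa [Module.finrank_fintype_fun_eq_card] at h

/-- four Hermitian roots with `Σ D_j = 0`, `Σ∧²D_j = 0` have joint range of dimension ≤ 3 … -/
theorem finrank_J_le_three {n : ℕ} (D : Fin 4 → Matrix (Fin n) (Fin n) ℂ) (hD : ∀ j, (D j).IsHermitian)
    (hsum : ∑ j, D j = 0) (h2 : Wedge2SumZero D) : Module.finrank ℂ (J D) ≤ 3 := by
  have hK : ∀ y a, rowVec D y a ∈ LinearMap.ker (sumFunctional (Fin 4)) := by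
    intro y a
    rw [LinearMap.mem_ker]
    show ∑ j, (D j *ᵥ y) a = 0
    rw [← Finset.sum_apply a Finset.univ (fun j => D j *ᵥ y), ← Matrix.sum_mulVec, hsum, Matrix.zero_mulVec]
    rfl
  have h := finrank_J_le D hD h2 _ hK
  have h' := finrank_ker_sumFunctional_lt (Fin 4)
  rw [Fintype.card_fin] at h'
  omega

/-- … hence every `D_j` has rank ≤ 3 and ALL 4×4 MINORS VANISH: `NoSplitWindow n` for every `n` (g23 memo §3, now kernel-checked and
without the Gram re-basis). -/
theorem noSplitWindow_all (n : ℕ) : NoSplitWindow n := by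
  intro D hD hsum h2 j r s
  have hJ := finrank_J_le_three D hD hsum h2
  have hrank : ((D j).submatrix r s).rank ≤ 3 :=
    calc ((D j).submatrix r s).rank ≤ (D j).rank := Matrix.rank_submatrix_le _ _ _
      _ ≤ Module.finrank ℂ (J D) := rank_le_finrank_J D j
      _ ≤ 3 := hJ
  by_contra hdet
  change ((D j).submatrix r s).det ≠ 0 at hdet
  have hU : IsUnit ((D j).submatrix r s) :=
    (Matrix.isUnit_iff_isUnit_det _).mpr (isUnit_iff_ne_zero.mpr hdet)
  have h4 := Matrix.rank_of_isUnit _ hU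
  rw [Fintype.card_fin] at h4
  omega

theorem nswReduction_all (n : ℕ) : NSWReduction n := fun _ => noSplitWindow_all n

/-- COROLLARY NSW, now UNCONDITIONAL: no Hermitian family is a numerically split point of the WNSH-LF window. -/
theorem not_splitWNSH {n : ℕ} (D : Fin 4 → Matrix (Fin n) (Fin n) ℂ) (herm : ∀ j, (D j).IsHermitian) :
    ¬ SplitWNSH D := by
  rintro ⟨hsum, h2, -, r, s, hne⟩
  apply hne
  unfold wedge4Sum
  exact Finset.sum_eq_zero fun j _ => noSplitWindow_all n D herm hsum h2 j r s

end Consequences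

end HSemireg.C4RankLemma
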